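import Summits.QuantumFields.YangMills.Theorems.PoincareLipschitzLatticeToContinuumSobolevLetters
import Mathlib.MeasureTheory.Measure.Lebesgue.EqHaar
import HarnessLib

/-!
# LINE 25 «CompactnessTransfer» (K2 crux `BlockLipschitzL` stmt-QuantumFields-23533 ∕ crux of record `HistoryTailL` stmt-QuantumFields-19936), S1″ row (C)
# — (C)-PROOF brick (C-d) «COMPETITOR TRANSFER»: FILE D1 «THE BALL-SPLITTING COMPETITOR INEQUALITY»

The comparison step in the proof of compactness of energy minimising maps (L. Simon, *Energy Minimizing Maps* §2.9, proof of
Lemma 1; for sphere targets with the Hardt–Kinderlehrer–Lin competitor in place of Luckhaus' lemma), for ONE map — no sequence,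
no limit.  Letters: an open `Ω ⊆ ℝ³` (the (C) def instantiates the cube `Q`), maps `u v w : ℝ³ → ℝ⁴` with weak gradients
`Gu Gv Gw` on `Ω` (`Literature.Analysis.FunctionSpaces.HasWeakFDerivOn Ω volume · ·`) and integrable Dirichlet densities
`dens G x = ∑ i, ‖G x eᵢ‖²` on `Ω`; a centre `y` and radii `ρ₁ ≤ ρ₂ ≤ ρ` with `ball y ρ ⊆ Ω`.

If the glued map `w` agrees with `v` on `ball y ρ₁` and with `u` on `Ω` off `ball y ρ₂` (this is what the shell interpolation
`χv + (1−χ)u` composed with a ray projection `π_p` — which fixes `S³` — delivers), and `u` minimises against `w` on `ball y ρ`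
(`∫_{B_ρ} dens Gu ≤ ∫_{B_ρ} dens Gw`), then

  `∫_{B_{ρ₂}} dens Gu ≤ ∫_{B_{ρ₁}} dens Gv + ∫_{B_{ρ₂} ∖ B_{ρ₁}} dens Gw`            (★ `competitor_transfer`)

— the energy of `u` on the middle ball is at most the energy of `v` on the inner ball plus the energy of the glued map on the
shell.  Ingredients: LOCALITY of weak gradients (✓`…LatticeToContinuumSobolevLetters.weakFDeriv_ae_eq_of_eqOn`: `Gw = Gv` a.e. on
the open `ball y ρ₁`, `Gw = Gu` a.e. on the open `Ω ∖ closedBall y ρ₂`), the null sphere (Mathlib `Measure.addHaar_sphere`), and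
additivity of set integrals.  §4 restates (★) with the minimality hypothesis in the exact shape of the clause of
lit `Literature.Analysis.PDE.MinimisingMapCompactness` (a ball-minimiser on the cube against unit finite-energy competitors agreeing
with it off a smaller concentric ball), so that the (C)-knit consumes it by `exact`.

Cell `ym3-torus` (YM ladder rung R3 = continuum SU(2) Yang–Mills on T³ — a RUNG, NOT the Clay problem: not d = 4, not infinite
volume, not a mass gap); width seat `ym3-torus-px16` gen 9; (C)-PROOF lineage of `ym-ust-19936-w2` (LEAD ★w1-19936 g10 «GO (C)-PROOF»).
THEOREMS ONLY (0 `def`, 0 `sorry`, default heartbeats); `--supports stmt-QuantumFields-23533 --as helper`.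
HONEST SCOPE.  One comparison inequality; (C) `MinimisingMapCompactness`, (RS), S1″, K1, `MeanDeviationL`, `BlockLipschitzL`,
`HistoryTailL` are NOT proved here; YM gap NOT proved.

References: L. Simon, Theorems on Regularity and Singularity of Energy Minimizing Maps (1996), §2.9 Lemma 1 (proof, comparison
step) [Simon1996]; R. Hardt, D. Kinderlehrer, F.-H. Lin, Comm. Math. Phys. 105 (1986) 547–570, §2 [HardtKinderlehrerLin1986];
L. C. Evans, Partial Differential Equations (2010), §5.2.1 (locality of weak derivatives) [Evans2010].
-/

set_option autoImplicit false

noncomputable section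

open scoped BigOperators
open MeasureTheory Set Filter Topology TopologicalSpace Metric

namespace Summit.QuantumFields.YangMills.Theorems.PoincareLipschitzCompetitorTransfer

open Literature.Analysis.FunctionSpaces (HasWeakFDerivOn)
open Summit.QuantumFields.YangMills.Theorems.PoincareLipschitzLatticeToContinuumSobolevLetters (weakFDeriv_ae_eq_of_eqOn)

/-! ## §1 Locality of the Dirichlet density on balls and off closed balls -/

/-- ★ **INNER LOCALITY.**  If `w = v` on the open ball `ball y ρ₁ ⊆ Ω`, the Dirichlet densities of their weak gradients agree a.e.
on that ball. [cite: Evans2010, §5.2.1] -/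
theorem dens_ae_eq_on_ball {Ω : Opens (EuclideanSpace ℝ (Fin 3))}
    {v w : EuclideanSpace ℝ (Fin 3) → EuclideanSpace ℝ (Fin 4)}
    {Gv Gw : EuclideanSpace ℝ (Fin 3) → (EuclideanSpace ℝ (Fin 3) →L[ℝ] EuclideanSpace ℝ (Fin 4))}
    (hv : HasWeakFDerivOn Ω volume v Gv) (hw : HasWeakFDerivOn Ω volume w Gw)
    {y : EuclideanSpace ℝ (Fin 3)} {ρ₁ : ℝ} (hsub : ball y ρ₁ ⊆ (Ω : Set _))
    (hin : ∀ x ∈ ball y ρ₁, w x = v x) :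
    ∀ᵐ x ∂(volume.restrict (ball y ρ₁)),
      (∑ i : Fin 3, ‖Gw x (EuclideanSpace.single i (1:ℝ))‖ ^ 2) = ∑ i : Fin 3, ‖Gv x (EuclideanSpace.single i (1:ℝ))‖ ^ 2 := by
  set Ω' : Opens (EuclideanSpace ℝ (Fin 3)) := ⟨ball y ρ₁, isOpen_ball⟩ with hΩ'
  have hle : Ω' ≤ Ω := fun x hx => hsub hx
  have hae := weakFDeriv_ae_eq_of_eqOn hv hw hle fun x hx => hin x hx
  filter_upwards [hae] with x hx
  simp only [hx]

/-- ★ **OUTER LOCALITY.**  If `w = u` on `Ω` off the open ball `ball y ρ₂`, the Dirichlet densities of their weak gradients agree a.e.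
on `Ω ∖ closedBall y ρ₂` (an open set on which `w = u`). [cite: Evans2010, §5.2.1] -/
theorem dens_ae_eq_off_closedBall {Ω : Opens (EuclideanSpace ℝ (Fin 3))}
    {u w : EuclideanSpace ℝ (Fin 3) → EuclideanSpace ℝ (Fin 4)}
    {Gu Gw : EuclideanSpace ℝ (Fin 3) → (EuclideanSpace ℝ (Fin 3) →L[ℝ] EuclideanSpace ℝ (Fin 4))}
    (hu : HasWeakFDerivOn Ω volume u Gu) (hw : HasWeakFDerivOn Ω volume w Gw)
    {y : EuclideanSpace ℝ (Fin 3)} {ρ₂ : ℝ}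
    (hout : ∀ x ∈ (Ω : Set _), x ∉ ball y ρ₂ → w x = u x) :
    ∀ᵐ x ∂(volume.restrict ((Ω : Set _) \ closedBall y ρ₂)),
      (∑ i : Fin 3, ‖Gw x (EuclideanSpace.single i (1:ℝ))‖ ^ 2) = ∑ i : Fin 3, ‖Gu x (EuclideanSpace.single i (1:ℝ))‖ ^ 2 := by
  set Ω' : Opens (EuclideanSpace ℝ (Fin 3)) := ⟨(Ω : Set _) \ closedBall y ρ₂, Ω.isOpen.sdiff isClosed_closedBall⟩ with hΩ'
  have hle : Ω' ≤ Ω := fun x hx => hx.1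
  have hae := weakFDeriv_ae_eq_of_eqOn hu hw hle fun x hx => hout x hx.1 fun hb => hx.2 (ball_subset_closedBall hb)
  filter_upwards [hae] with x hx
  simp only [hx]

/-- ★ **OUTER LOCALITY UP TO THE NULL SPHERE.**  Same, a.e. on `Ω ∖ ball y ρ₂`: the two sets differ by the sphere `sphere y ρ₂`, which is
Lebesgue-null (Mathlib `Measure.addHaar_sphere`). [cite: Evans2010, §5.2.1] -/
theorem dens_ae_eq_off_ball {Ω : Opens (EuclideanSpace ℝ (Fin 3))}
    {u w : EuclideanSpace ℝ (Fin 3) → EuclideanSpace ℝ (Fin 4)}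
    {Gu Gw : EuclideanSpace ℝ (Fin 3) → (EuclideanSpace ℝ (Fin 3) →L[ℝ] EuclideanSpace ℝ (Fin 4))}
    (hu : HasWeakFDerivOn Ω volume u Gu) (hw : HasWeakFDerivOn Ω volume w Gw)
    {y : EuclideanSpace ℝ (Fin 3)} {ρ₂ : ℝ}
    (hout : ∀ x ∈ (Ω : Set _), x ∉ ball y ρ₂ → w x = u x) :
    ∀ᵐ x ∂(volume.restrict ((Ω : Set _) \ ball y ρ₂)),
      (∑ i : Fin 3, ‖Gw x (EuclideanSpace.single i (1:ℝ))‖ ^ 2) = ∑ i : Fin 3, ‖Gu x (EuclideanSpace.single i (1:ℝ))‖ ^ 2 := by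
  have h1 := dens_ae_eq_off_closedBall hu hw hout
  have hS : volume (sphere y ρ₂) = 0 := Measure.addHaar_sphere volume y ρ₂
  have hS' : ∀ᵐ x ∂(volume : Measure (EuclideanSpace ℝ (Fin 3))), x ∉ sphere y ρ₂ := measure_eq_zero_iff_ae_notMem.1 hS
  have hmeas1 : MeasurableSet ((Ω : Set (EuclideanSpace ℝ (Fin 3))) \ closedBall y ρ₂) :=
    Ω.isOpen.measurableSet.diff isClosed_closedBall.measurableSet
  have hmeas2 : MeasurableSet ((Ω : Set (EuclideanSpace ℝ (Fin 3))) \ ball y ρ₂) :=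
    Ω.isOpen.measurableSet.diff isOpen_ball.measurableSet
  rw [ae_restrict_iff' hmeas1] at h1
  rw [ae_restrict_iff' hmeas2]
  filter_upwards [h1, hS'] with x hx hxS hx2
  refine hx ⟨hx2.1, fun hc => ?_⟩
  -- `x ∈ closedBall ∖ ball = sphere`, contradiction
  exact hxS (mem_sphere.2 (le_antisymm (mem_closedBall.1 hc) (not_lt.1 fun h => hx2.2 (mem_ball.2 h))))

/-! ## §2 Splitting a set integral over nested balls -/

/-- Splitting the integral over `ball y ρ` at an inner concentric ball `ball y ρ₂`, `ρ₂ ≤ ρ`. [folklore] -/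
theorem setIntegral_ball_eq_add_sdiff {f : EuclideanSpace ℝ (Fin 3) → ℝ} {y : EuclideanSpace ℝ (Fin 3)} {ρ₂ ρ : ℝ}
    (hρ : ρ₂ ≤ ρ) (hf : IntegrableOn f (ball y ρ) volume) :
    ∫ x in ball y ρ, f x = (∫ x in ball y ρ₂, f x) + ∫ x in ball y ρ \ ball y ρ₂, f x := by
  have hinter : ball y ρ ∩ ball y ρ₂ = ball y ρ₂ := inter_eq_right.2 (ball_subset_ball hρ)
  rw [← integral_inter_add_sdiff (isOpen_ball (x := y) (ε := ρ₂)).measurableSet hf, hinter]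

/-! ## §3 The ball-splitting competitor inequality -/

/-- ★★★ **COMPETITOR TRANSFER — THE BALL-SPLITTING INEQUALITY** (Simon 1996 §2.9, proof of Lemma 1, comparison step; HKL 1986 §2 for
sphere targets).  Let `u, v, w` have weak gradients `Gu, Gv, Gw` on the open `Ω ⊆ ℝ³` with integrable Dirichlet densities, let
`ρ₁ ≤ ρ₂ ≤ ρ` with `ball y ρ ⊆ Ω`, and suppose the glued map `w` equals `v` on `ball y ρ₁` and equals `u` on `Ω` off `ball y ρ₂`.  If `u`
minimises against `w` on `ball y ρ` — `∫_{B_ρ} dens Gu ≤ ∫_{B_ρ} dens Gw` — then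
`∫_{B_{ρ₂}} dens Gu ≤ ∫_{B_{ρ₁}} dens Gv + ∫_{B_{ρ₂} ∖ B_{ρ₁}} dens Gw`. [cite: Simon1996, §2.9 Lemma 1 (proof, comparison step)] -/
theorem competitor_transfer {Ω : Opens (EuclideanSpace ℝ (Fin 3))}
    {u v w : EuclideanSpace ℝ (Fin 3) → EuclideanSpace ℝ (Fin 4)}
    {Gu Gv Gw : EuclideanSpace ℝ (Fin 3) → (EuclideanSpace ℝ (Fin 3) →L[ℝ] EuclideanSpace ℝ (Fin 4))}
    (hu : HasWeakFDerivOn Ω volume u Gu) (hv : HasWeakFDerivOn Ω volume v Gv) (hw : HasWeakFDerivOn Ω volume w Gw)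
    (hui : IntegrableOn (fun x => ∑ i : Fin 3, ‖Gu x (EuclideanSpace.single i (1:ℝ))‖ ^ 2) (Ω : Set _) volume)
    (hwi : IntegrableOn (fun x => ∑ i : Fin 3, ‖Gw x (EuclideanSpace.single i (1:ℝ))‖ ^ 2) (Ω : Set _) volume)
    {y : EuclideanSpace ℝ (Fin 3)} {ρ₁ ρ₂ ρ : ℝ} (h₁₂ : ρ₁ ≤ ρ₂) (h₂ : ρ₂ ≤ ρ) (hρΩ : ball y ρ ⊆ (Ω : Set _))
    (hin : ∀ x ∈ ball y ρ₁, w x = v x)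
    (hout : ∀ x ∈ (Ω : Set _), x ∉ ball y ρ₂ → w x = u x)
    (hmin : ∫ x in ball y ρ, ∑ i : Fin 3, ‖Gu x (EuclideanSpace.single i (1:ℝ))‖ ^ 2
      ≤ ∫ x in ball y ρ, ∑ i : Fin 3, ‖Gw x (EuclideanSpace.single i (1:ℝ))‖ ^ 2) :
    ∫ x in ball y ρ₂, ∑ i : Fin 3, ‖Gu x (EuclideanSpace.single i (1:ℝ))‖ ^ 2
      ≤ (∫ x in ball y ρ₁, ∑ i : Fin 3, ‖Gv x (EuclideanSpace.single i (1:ℝ))‖ ^ 2)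
        + ∫ x in ball y ρ₂ \ ball y ρ₁, ∑ i : Fin 3, ‖Gw x (EuclideanSpace.single i (1:ℝ))‖ ^ 2 := by
  -- abbreviations for the three densities
  set du : EuclideanSpace ℝ (Fin 3) → ℝ := fun x => ∑ i : Fin 3, ‖Gu x (EuclideanSpace.single i (1:ℝ))‖ ^ 2 with hdu
  set dv : EuclideanSpace ℝ (Fin 3) → ℝ := fun x => ∑ i : Fin 3, ‖Gv x (EuclideanSpace.single i (1:ℝ))‖ ^ 2 with hdv
  set dw : EuclideanSpace ℝ (Fin 3) → ℝ := fun x => ∑ i : Fin 3, ‖Gw x (EuclideanSpace.single i (1:ℝ))‖ ^ 2 with hdw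
  have hρ₂Ω : ball y ρ₂ ⊆ (Ω : Set _) := (ball_subset_ball h₂).trans hρΩ
  have hρ₁Ω : ball y ρ₁ ⊆ (Ω : Set _) := (ball_subset_ball h₁₂).trans hρ₂Ω
  -- integrability on the balls
  have huρ : IntegrableOn du (ball y ρ) volume := hui.mono_set hρΩ
  have hwρ : IntegrableOn dw (ball y ρ) volume := hwi.mono_set hρΩ
  have hwρ₂ : IntegrableOn dw (ball y ρ₂) volume := hwi.mono_set hρ₂Ω
  -- (1) split both sides of `hmin` at `ρ₂`
  have hsu := setIntegral_ball_eq_add_sdiff (f := du) h₂ huρ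
  have hsw := setIntegral_ball_eq_add_sdiff (f := dw) h₂ hwρ
  -- (2) outer identity: `dw = du` a.e. on `ball y ρ ∖ ball y ρ₂ ⊆ Ω ∖ ball y ρ₂`
  have hsub : ball y ρ \ ball y ρ₂ ⊆ (Ω : Set _) \ ball y ρ₂ := fun x hx => ⟨hρΩ hx.1, hx.2⟩
  have hout_ae : ∀ᵐ x ∂(volume.restrict (ball y ρ \ ball y ρ₂)), dw x = du x :=
    ae_restrict_of_ae_restrict_of_subset hsub (dens_ae_eq_off_ball hu hw hout)
  have hout_int : ∫ x in ball y ρ \ ball y ρ₂, dw x = ∫ x in ball y ρ \ ball y ρ₂, du x := integral_congr_ae hout_ae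
  -- hence `∫_{B_{ρ₂}} du ≤ ∫_{B_{ρ₂}} dw`
  have hmid : ∫ x in ball y ρ₂, du x ≤ ∫ x in ball y ρ₂, dw x := by
    have h := hmin
    rw [hsu, hsw, hout_int] at h
    linarith
  -- (3) split `∫_{B_{ρ₂}} dw` at `ρ₁` and use the inner identity `dw = dv` a.e. on `ball y ρ₁`
  have hsw₂ := setIntegral_ball_eq_add_sdiff (f := dw) h₁₂ hwρ₂
  have hin_int : ∫ x in ball y ρ₁, dw x = ∫ x in ball y ρ₁, dv x :=
    integral_congr_ae (dens_ae_eq_on_ball hv hw hρ₁Ω hin)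
  rw [hsw₂, hin_int] at hmid
  exact hmid

/-- ★★ **COROLLARY — AGAINST THE INNER MAP ON THE WHOLE MIDDLE BALL.**  Under the same hypotheses PLUS integrability of `dens Gv`,
`∫_{B_{ρ₂}} dens Gu ≤ ∫_{B_{ρ₂}} dens Gv + ∫_{B_{ρ₂} ∖ B_{ρ₁}} dens Gw` (enlarge `B_{ρ₁}` to `B_{ρ₂}` on the `v`-side, the density being
nonnegative) — the form used with `v := U` (the limit map) in the energy-convergence step. [cite: Simon1996, §2.9 Lemma 1 (proof, comparison step)] -/
theorem competitor_transfer_middle {Ω : Opens (EuclideanSpace ℝ (Fin 3))}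
    {u v w : EuclideanSpace ℝ (Fin 3) → EuclideanSpace ℝ (Fin 4)}
    {Gu Gv Gw : EuclideanSpace ℝ (Fin 3) → (EuclideanSpace ℝ (Fin 3) →L[ℝ] EuclideanSpace ℝ (Fin 4))}
    (hu : HasWeakFDerivOn Ω volume u Gu) (hv : HasWeakFDerivOn Ω volume v Gv) (hw : HasWeakFDerivOn Ω volume w Gw)
    (hui : IntegrableOn (fun x => ∑ i : Fin 3, ‖Gu x (EuclideanSpace.single i (1:ℝ))‖ ^ 2) (Ω : Set _) volume)
    (hvi : IntegrableOn (fun x => ∑ i : Fin 3, ‖Gv x (EuclideanSpace.single i (1:ℝ))‖ ^ 2) (Ω : Set _) volume)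
    (hwi : IntegrableOn (fun x => ∑ i : Fin 3, ‖Gw x (EuclideanSpace.single i (1:ℝ))‖ ^ 2) (Ω : Set _) volume)
    {y : EuclideanSpace ℝ (Fin 3)} {ρ₁ ρ₂ ρ : ℝ} (h₁₂ : ρ₁ ≤ ρ₂) (h₂ : ρ₂ ≤ ρ) (hρΩ : ball y ρ ⊆ (Ω : Set _))
    (hin : ∀ x ∈ ball y ρ₁, w x = v x)
    (hout : ∀ x ∈ (Ω : Set _), x ∉ ball y ρ₂ → w x = u x)
    (hmin : ∫ x in ball y ρ, ∑ i : Fin 3, ‖Gu x (EuclideanSpace.single i (1:ℝ))‖ ^ 2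
      ≤ ∫ x in ball y ρ, ∑ i : Fin 3, ‖Gw x (EuclideanSpace.single i (1:ℝ))‖ ^ 2) :
    ∫ x in ball y ρ₂, ∑ i : Fin 3, ‖Gu x (EuclideanSpace.single i (1:ℝ))‖ ^ 2
      ≤ (∫ x in ball y ρ₂, ∑ i : Fin 3, ‖Gv x (EuclideanSpace.single i (1:ℝ))‖ ^ 2)
        + ∫ x in ball y ρ₂ \ ball y ρ₁, ∑ i : Fin 3, ‖Gw x (EuclideanSpace.single i (1:ℝ))‖ ^ 2 := by
  have h := competitor_transfer hu hv hw hui hwi h₁₂ h₂ hρΩ hin hout hmin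
  have hρ₂Ω : ball y ρ₂ ⊆ (Ω : Set _) := (ball_subset_ball h₂).trans hρΩ
  have hmono : (∫ x in ball y ρ₁, ∑ i : Fin 3, ‖Gv x (EuclideanSpace.single i (1:ℝ))‖ ^ 2)
      ≤ ∫ x in ball y ρ₂, ∑ i : Fin 3, ‖Gv x (EuclideanSpace.single i (1:ℝ))‖ ^ 2 :=
    setIntegral_mono_set (hvi.mono_set hρ₂Ω)
      (Eventually.of_forall fun x => Finset.sum_nonneg fun i _ => by positivity)
      (Eventually.of_forall (ball_subset_ball h₁₂))
  linarith

/-! ## §4 The same, with the minimality clause of `MinimisingMapCompactness` verbatim -/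

/-- ★★★ **COMPETITOR TRANSFER FOR A BALL-MINIMISER OF THE (C) CLASS.**  On the open unit cube `Q ⊂ ℝ³`: let `u` have weak gradient `Gu` with
integrable density and satisfy, at the ball `ball y ρ` (`closedBall y ρ ⊆ Q`), the minimality clause of
lit `Literature.Analysis.PDE.MinimisingMapCompactness` VERBATIM (against every unit finite-energy `W^{1,2}` competitor agreeing with `u` off a
smaller concentric ball); let `v` have weak gradient `Gv` on `Q`; let the glued map `w` be unit on `Q` with weak gradient `Gw` and
integrable density, `w = v` on `ball y ρ₁` and `w = u` off `ball y ρ₂` (everywhere), `ρ₁ ≤ ρ₂ < ρ`.  Then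
`∫_{B_{ρ₂}} dens Gu ≤ ∫_{B_{ρ₁}} dens Gv + ∫_{B_{ρ₂} ∖ B_{ρ₁}} dens Gw`. [cite: Simon1996, §2.9 Lemma 1 (proof, comparison step)] -/
theorem competitor_transfer_of_ballMinimiser (hQ : IsOpen {x : EuclideanSpace ℝ (Fin 3) | ∀ i : Fin 3, |x i| < 1})
    {u v w : EuclideanSpace ℝ (Fin 3) → EuclideanSpace ℝ (Fin 4)}
    {Gu Gv Gw : EuclideanSpace ℝ (Fin 3) → (EuclideanSpace ℝ (Fin 3) →L[ℝ] EuclideanSpace ℝ (Fin 4))}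
    (hu : HasWeakFDerivOn ⟨{x : EuclideanSpace ℝ (Fin 3) | ∀ i : Fin 3, |x i| < 1}, hQ⟩ volume u Gu)
    (hui : IntegrableOn (fun x => ∑ i : Fin 3, ‖Gu x (EuclideanSpace.single i (1:ℝ))‖ ^ 2)
      {x : EuclideanSpace ℝ (Fin 3) | ∀ i : Fin 3, |x i| < 1} volume)
    {y : EuclideanSpace ℝ (Fin 3)} {ρ : ℝ}
    (hρQ : closedBall y ρ ⊆ {x : EuclideanSpace ℝ (Fin 3) | ∀ i : Fin 3, |x i| < 1})
    (hmin : ∀ (W : EuclideanSpace ℝ (Fin 3) → EuclideanSpace ℝ (Fin 4))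
        (GW : EuclideanSpace ℝ (Fin 3) → (EuclideanSpace ℝ (Fin 3) →L[ℝ] EuclideanSpace ℝ (Fin 4))),
      HasWeakFDerivOn ⟨{x : EuclideanSpace ℝ (Fin 3) | ∀ i : Fin 3, |x i| < 1}, hQ⟩ volume W GW →
      (∀ x : EuclideanSpace ℝ (Fin 3), (∀ i : Fin 3, |x i| < 1) → ‖W x‖ = 1) →
      IntegrableOn (fun x => ∑ i : Fin 3, ‖GW x (EuclideanSpace.single i (1:ℝ))‖ ^ 2)
        {x : EuclideanSpace ℝ (Fin 3) | ∀ i : Fin 3, |x i| < 1} →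
      (∃ ρ' : ℝ, ρ' < ρ ∧ ∀ x : EuclideanSpace ℝ (Fin 3), x ∉ ball y ρ' → W x = u x) →
      ∫ x in ball y ρ, ∑ i : Fin 3, ‖Gu x (EuclideanSpace.single i (1:ℝ))‖ ^ 2
        ≤ ∫ x in ball y ρ, ∑ i : Fin 3, ‖GW x (EuclideanSpace.single i (1:ℝ))‖ ^ 2)
    (hv : HasWeakFDerivOn ⟨{x : EuclideanSpace ℝ (Fin 3) | ∀ i : Fin 3, |x i| < 1}, hQ⟩ volume v Gv)
    (hw : HasWeakFDerivOn ⟨{x : EuclideanSpace ℝ (Fin 3) | ∀ i : Fin 3, |x i| < 1}, hQ⟩ volume w Gw)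
    (hw1 : ∀ x : EuclideanSpace ℝ (Fin 3), (∀ i : Fin 3, |x i| < 1) → ‖w x‖ = 1)
    (hwi : IntegrableOn (fun x => ∑ i : Fin 3, ‖Gw x (EuclideanSpace.single i (1:ℝ))‖ ^ 2)
      {x : EuclideanSpace ℝ (Fin 3) | ∀ i : Fin 3, |x i| < 1} volume)
    {ρ₁ ρ₂ : ℝ} (h₁₂ : ρ₁ ≤ ρ₂) (h₂ : ρ₂ < ρ)
    (hin : ∀ x ∈ ball y ρ₁, w x = v x)
    (hout : ∀ x : EuclideanSpace ℝ (Fin 3), x ∉ ball y ρ₂ → w x = u x) :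
    ∫ x in ball y ρ₂, ∑ i : Fin 3, ‖Gu x (EuclideanSpace.single i (1:ℝ))‖ ^ 2
      ≤ (∫ x in ball y ρ₁, ∑ i : Fin 3, ‖Gv x (EuclideanSpace.single i (1:ℝ))‖ ^ 2)
        + ∫ x in ball y ρ₂ \ ball y ρ₁, ∑ i : Fin 3, ‖Gw x (EuclideanSpace.single i (1:ℝ))‖ ^ 2 := by
  have hmin' := hmin w Gw hw hw1 hwi ⟨ρ₂, h₂, hout⟩
  have hρΩ : ball y ρ ⊆ ((⟨{x : EuclideanSpace ℝ (Fin 3) | ∀ i : Fin 3, |x i| < 1}, hQ⟩ :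
      Opens (EuclideanSpace ℝ (Fin 3))) : Set _) := ball_subset_closedBall.trans hρQ
  exact competitor_transfer hu hv hw hui hwi h₁₂ h₂.le hρΩ hin (fun x _ hx => hout x hx) hmin'

end Summit.QuantumFields.YangMills.Theorems.PoincareLipschitzCompetitorTransfer

end
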